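import Summits.BirchSwinnertonDyer.BirchSwinnertonDyer.Theorems.EisensteinPrimesMazurMCOnCellBTwistbackSubrowPartnerAnyLine
import Summits.BirchSwinnertonDyer.BirchSwinnertonDyer.Theorems.EisensteinPrimesMazurMCOnCellBTwistbackSubrowPartnerGivenPAdicGZ
import HarnessLib

/-!
# Crux 3 `MazurMCOnCellB` (stmt-BirchSwinnertonDyer-19033), line `twistback` v5 — the sub-row doors WITHOUT Keller–Yin:
# part 2, `p = 3` with the field CHOSEN, any rational `3`-line, balance one — the exact door the skeleton's
# `upperPartner_onSubrow` consumes, `_of_padicGZ`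

Width seat bsd-line-x2-p1-w3 (g11), 2026-08-28; sequel of `…TwistbackSubrowPartnerGivenPAdicGZ` (this seat) over LEAD g11's
`…TwistbackSubrowPartner` (p655083) and `…TwistbackSubrowPartnerAnyLine` (p655437). HONEST FRAMING (cell `bsd-eis`,
run/shared/lean/pub/bsd-eis/): conditional theorems only; named facts BY NAME — the route's `PublishedInputs`
(stmt-…-19037), Disegni 2020 Thm. 4(1) (`padicBSD_rankOne_nonsplitMult`), Greenberg–Vatsal Thm. (3.11) (`h311`),
Nakagawa–Horie 1988 + Taya 2000 (`nakagawaHorie_taya_exists_imaginary_h3_eq_one`) and Disegni 2020 Thm. 2.4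
(`padicGrossZagier_nonsplitMult`) — ALL PUBLISHED; every theorem below is the `_of_thmE` theorem of the same name with
`hDD` (Dokchitser–Dokchitser) + `hKY` (Keller–Yin Thm. E, PRE) REPLACED by the single `hDGZ`. In particular §3
`upperPartner_at_three_of_balanceOne_of_padicGZ` has EXACTLY the binders the skeleton v5's `upperPartner_onSubrow` feeds to
p655437 minus `hDD`/`hKY` plus `hDGZ`, so the LEAD can make the sub-row «`p = 3`, non-split, local balance `1`» of crux 3
PUB-only (`stub_kellerYinThmDE` ↦ `stub_thmD`, one more conjunct in `stub_printedFacts`) — a decision this seat does NOT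
take (W-79). No `def`, no `sorry`; nothing about any curve is proved unconditionally; no main conjecture / BSD; 0 cells /
labels / stubs / tiers move.

* §1 `upperPartner_at_three_of_{ramifiedOdd,unramifiedEven}_of_padicGZ` — LEAD g11's p655083 §3 (field chosen by
  Nakagawa–Horie–Taya) over part 1's `K`-given doors.
* §2 `upperPartner_at_three_of_line_of_padicGZ` — p655437 §2 (any rational `3`-line: Tate line decides the shape).
* §3 `upperPartner_at_three_of_balanceOne_of_padicGZ` — p655437 §3 (the line datum existential).

References: [Disegni2020] §2.2 Thm. 2.4, §3.2 Thm. 4; [NakagawaHorie1988] Thm. 1; [GreenbergVatsal2000] Thm. (1.3), §2,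
§3 Thm. (3.11); [Wuthrich2014] Thm. 16; [PerrinRiou1987] §1.4; [SilvermanATAEC1994] Thm. V.5.3.
-/

set_option autoImplicit false

-- `Summit.BirchSwinnertonDyer.BirchSwinnertonDyer.…`: the summit and its single sub-problem share a name.
set_option linter.dupNamespace false

noncomputable section

open scoped Classical MatrixGroups ModularForm NumberTheorySymbols

open CongruenceSubgroup WeierstrassCurve NumberField IsDedekindDomain Field DirichletCharacter Rat.HeightOneSpectrum
  Literature.NumberTheory.EllipticCurves Literature.NumberTheory.GaloisRepresentations
  Literature.NumberTheory.EllipticCurves.ModularForms Literature.NumberTheory.QuadraticFields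
  Literature.NumberTheory.EllipticCurves.Rank1Residual Literature.NumberTheory.EllipticCurves.Rank1Residual.Typed
  Literature.NumberTheory.EllipticCurves.Wuthrich2014 Literature.NumberTheory.EllipticCurves.GreenbergVatsal2000
  Literature.NumberTheory.EllipticCurves.Disegni2020 Literature.NumberTheory.LFunctions
  Summit.BirchSwinnertonDyer.Rank1Residual Summit.BirchSwinnertonDyer.Rank1Residual.X2
  Summit.BirchSwinnertonDyer.BirchSwinnertonDyer.Theses
  Summit.BirchSwinnertonDyer.BirchSwinnertonDyer.Theorems.EisensteinPrimesLineWeilRelation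
  Summit.BirchSwinnertonDyer.BirchSwinnertonDyer.Theorems.EisensteinPrimesMazurMCOnCellBTwistbackKLFieldSupply
  Summit.BirchSwinnertonDyer.BirchSwinnertonDyer.Theorems.EisensteinPrimesMazurMCOnCellBTwistbackKLFieldSupplyClassNumber
  Summit.BirchSwinnertonDyer.BirchSwinnertonDyer.Theorems.EisensteinPrimesMazurMCOnCellBTwistbackPartnerClassNumberLift
  Summit.BirchSwinnertonDyer.BirchSwinnertonDyer.Theorems.EisensteinPrimesLinePsiAtMultiplicativePrime
  Summit.BirchSwinnertonDyer.BirchSwinnertonDyer.Theorems.EisensteinPrimesLinePhiAtMultiplicativePrime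
  Summit.BirchSwinnertonDyer.BirchSwinnertonDyer.Theorems.EisensteinPrimesMazurMCOnCellBTwistbackSubrowPartnerGiven
  Summit.BirchSwinnertonDyer.BirchSwinnertonDyer.Theorems.EisensteinPrimesMazurMCOnCellBTwistbackSubrowPartner
  Summit.BirchSwinnertonDyer.BirchSwinnertonDyer.Theorems.EisensteinPrimesMazurMCOnCellBTwistbackSubrowPartnerAnyLine
  Summit.BirchSwinnertonDyer.BirchSwinnertonDyer.Theorems.EisensteinPrimesMazurMCOnCellBTwistbackSubrowPartnerGivenPAdicGZ
  Summit.BirchSwinnertonDyer.Rank1Residual.X2.ResidualLineCharacters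
  Summit.BirchSwinnertonDyer.Rank1Residual.X2.ResidualLineCharactersOdd
  Summit.BirchSwinnertonDyer.Rank1Residual.X2.PrimeOrderCharacters
  Literature.NumberTheory.EllipticCurves.TateCurve

namespace Summit.BirchSwinnertonDyer.BirchSwinnertonDyer.Theorems.EisensteinPrimesMazurMCOnCellBTwistbackSubrowPartnerAnyLinePAdicGZ

/-! ## §1. `p = 3`, the field `K` CHOSEN (Nakagawa–Horie–Taya), both X2b shapes -/

section Three

variable (W : WeierstrassCurve ℚ) [W.IsElliptic] [W.IsGloballyMinimal]

/-- **Stub 6 (∃-PARTNER) at EVERY non-split X2b pair `(W, 3)` with a balance-one RAMIFIED-ODD line datum — `K` CHOSEN,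
PUBLISHED inputs only**: LEAD g11's `…SubrowPartner.upperPartner_at_three_of_ramifiedOdd_of_thmE` with `hDD` + `hKY`
REPLACED by `hDGZ` (`ψ` even with `ψ(3) = −1`; `exists_admissibleField_coprime_classNumber` supplies `K`; then part 1 §2).
[cite: NakagawaHorie1988, Thm. 1] [cite: KrizLi2019, §9 Thm. 9.4 (first assertion) and its proof]
[cite: GreenbergVatsal2000, §3 Thm. (3.11) (p. 43)] [cite: Disegni2020, §2.2 Thm. 2.4 and §3.2 Thm. 4] -/
theorem upperPartner_at_three_of_ramifiedOdd_of_padicGZ (hP : EisensteinPrimes.PublishedInputs)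
    (hDis : padicBSD_rankOne_nonsplitMult) (h311 : thm311_hasUnitContent_iff_and_order_eq_of_lineRamifiedEven)
    (hDGZ : padicGrossZagier_nonsplitMult)
    (hNH : Literature.NumberTheory.QuadraticFields.nakagawaHorie_taya_exists_imaginary_h3_eq_one)
    (hc : X2.CellB W 3) (hns : ¬ W.HasSplitMultiplicativeReductionAtPrime 3)
    {Φ₀ : AddSubgroup (geomTorsion W (3 : ℤ))} (hΦ : IsRationalLine W 3 Φ₀)
    (hram : ¬ LineUnramifiedAt W 3 Φ₀) (hodd : LineOdd W 3 Φ₀)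
    {m : ℕ} [NeZero m] (φ : DirichletCharacter (ZMod 3) m) {d : ℕ} [NeZero d]
    (ψ : DirichletCharacter (ZMod 3) d) (hφ : φ.IsPrimitive) (hψ : ψ.IsPrimitive) (hpm : 3 ∣ m)
    (hpd : ¬ 3 ∣ d)
    (hφ0 : ∀ (σ : absoluteGaloisGroup ℚ), ∀ P ∈ Φ₀,
      σ • P = (φ ((modNCyclotomicCharacter ℚ m σ : (ZMod m)ˣ) : ZMod m)).val • P)
    (hψ0 : ∀ (σ : absoluteGaloisGroup ℚ) (P : geomTorsion W (3 : ℤ)),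
      σ • P - (ψ ((modNCyclotomicCharacter ℚ d σ : (ZMod d)ˣ) : ZMod d)).val • P ∈ Φ₀)
    (S₀ : Finset (HeightOneSpectrum (𝓞 ℚ))) (hS₀p : ∀ v ∈ S₀, ((3 : ℕ) : 𝓞 ℚ) ∉ v.asIdeal)
    (hS : ∀ v : HeightOneSpectrum (𝓞 ℚ), v ∉ S₀ → ((3 : ℕ) : 𝓞 ℚ) ∉ v.asIdeal → W.HasGoodReductionAt v)
    (hbal : 1 + ∑ v ∈ S₀, delta W 3 v =
      ∑ v ∈ S₀, ((if φ (Rat.HeightOneSpectrum.natGenerator v : ZMod m) =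
            (Rat.HeightOneSpectrum.natGenerator v : ZMod 3)
          then sFactor 3 (Rat.HeightOneSpectrum.natGenerator v) else 0) +
        (if ψ (Rat.HeightOneSpectrum.natGenerator v : ZMod d) =
            (Rat.HeightOneSpectrum.natGenerator v : ZMod 3)
          then sFactor 3 (Rat.HeightOneSpectrum.natGenerator v) else 0))) :
    ∃ (K : Type) (_ : Field K) (_ : NumberField K), IsImaginaryQuadratic K ∧
      SatisfiesHeegnerHypothesis (W.conductorNorm ℤ) K ∧ SatisfiesHeegnerHypothesis 3 K ∧
      Odd (NumberField.discr K) ∧ NumberField.discr K < -4 ∧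
      (W.quadraticTwist (NumberField.discr K : ℚ)).analyticRank = 1 ∧
      ∀ (Wd : WeierstrassCurve ℚ) [Wd.IsElliptic] [Wd.IsGloballyMinimal],
        (∃ C : VariableChange ℚ, C • Wd = W.quadraticTwist (NumberField.discr K : ℚ)) →
        MissingUpperBoundAt Wd 3 := by
  have hevenψ : ψ.Even := even_quot_of_lineOdd hΦ hodd hφ0 hψ0
  have hψ3 : ψ (3 : ZMod d) = -1 :=
    psi_natCast_eq_neg_one_of_not_split (W := W) (p := 3) (by decide) hc.2.1.2.2 hns hΦ hram ψ hpd hψ0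
  obtain ⟨K, _, _, hK, hHN, hH3, hoddK, hlt, ⟨N₀, hHN₀, hS₀N₀⟩, hmK, hdK, hh⟩ :=
    exists_admissibleField_coprime_classNumber hNH (W.conductorNorm ℤ) W.conductorNorm_pos_holds m ψ hψ hevenψ
      hψ3 S₀
  exact upperPartner_at_of_ramifiedOdd_of_classNumber_of_padicGZ W 3 hP hDis h311 hDGZ hc hns hΦ hram hodd φ ψ hφ hψ hpm
    hpd (isQuadratic_of_zmod_three ψ) hφ0 hψ0 S₀ hS₀p hS hbal K hK hHN hH3 hoddK hlt hHN₀ hS₀N₀ hmK hdK hh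

/-- **Stub 6 (∃-PARTNER) at EVERY non-split X2b pair `(W, 3)` with a balance-one UNRAMIFIED-EVEN line datum — `K`
CHOSEN, PUBLISHED inputs only**: LEAD g11's `…SubrowPartner.upperPartner_at_three_of_unramifiedEven_of_thmE` with
`hDD` + `hKY` REPLACED by `hDGZ` (`φ` even, `φ(3) = −1`; supply at `n = m`; part 1 §2).
[cite: NakagawaHorie1988, Thm. 1] [cite: GreenbergVatsal2000, §3 Thm. (3.11) and §2 p. 28]
[cite: Disegni2020, §2.2 Thm. 2.4 and §3.2 Thm. 4] -/
theorem upperPartner_at_three_of_unramifiedEven_of_padicGZ (hP : EisensteinPrimes.PublishedInputs)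
    (hDis : padicBSD_rankOne_nonsplitMult) (h311 : thm311_hasUnitContent_iff_and_order_eq_of_lineRamifiedEven)
    (hDGZ : padicGrossZagier_nonsplitMult)
    (hNH : Literature.NumberTheory.QuadraticFields.nakagawaHorie_taya_exists_imaginary_h3_eq_one)
    (hc : X2.CellB W 3) (hns : ¬ W.HasSplitMultiplicativeReductionAtPrime 3)
    {Φ₀ : AddSubgroup (geomTorsion W (3 : ℤ))} (hΦ : IsRationalLine W 3 Φ₀)
    (hunr : LineUnramifiedAt W 3 Φ₀) (heven : LineEven W 3 Φ₀)
    {m : ℕ} [NeZero m] (φ : DirichletCharacter (ZMod 3) m) {d : ℕ} [NeZero d]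
    (ψ : DirichletCharacter (ZMod 3) d) (hφ : φ.IsPrimitive) (hψ : ψ.IsPrimitive) (hpm : ¬ 3 ∣ m)
    (hpd : 3 ∣ d)
    (hφ0 : ∀ (σ : absoluteGaloisGroup ℚ), ∀ P ∈ Φ₀,
      σ • P = (φ ((modNCyclotomicCharacter ℚ m σ : (ZMod m)ˣ) : ZMod m)).val • P)
    (hψ0 : ∀ (σ : absoluteGaloisGroup ℚ) (P : geomTorsion W (3 : ℤ)),
      σ • P - (ψ ((modNCyclotomicCharacter ℚ d σ : (ZMod d)ˣ) : ZMod d)).val • P ∈ Φ₀)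
    (S₀ : Finset (HeightOneSpectrum (𝓞 ℚ))) (hS₀p : ∀ v ∈ S₀, ((3 : ℕ) : 𝓞 ℚ) ∉ v.asIdeal)
    (hS : ∀ v : HeightOneSpectrum (𝓞 ℚ), v ∉ S₀ → ((3 : ℕ) : 𝓞 ℚ) ∉ v.asIdeal → W.HasGoodReductionAt v)
    (hbal : 1 + ∑ v ∈ S₀, delta W 3 v =
      ∑ v ∈ S₀, ((if φ (Rat.HeightOneSpectrum.natGenerator v : ZMod m) =
            (Rat.HeightOneSpectrum.natGenerator v : ZMod 3)
          then sFactor 3 (Rat.HeightOneSpectrum.natGenerator v) else 0) +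
        (if ψ (Rat.HeightOneSpectrum.natGenerator v : ZMod d) =
            (Rat.HeightOneSpectrum.natGenerator v : ZMod 3)
          then sFactor 3 (Rat.HeightOneSpectrum.natGenerator v) else 0))) :
    ∃ (K : Type) (_ : Field K) (_ : NumberField K), IsImaginaryQuadratic K ∧
      SatisfiesHeegnerHypothesis (W.conductorNorm ℤ) K ∧ SatisfiesHeegnerHypothesis 3 K ∧
      Odd (NumberField.discr K) ∧ NumberField.discr K < -4 ∧
      (W.quadraticTwist (NumberField.discr K : ℚ)).analyticRank = 1 ∧
      ∀ (Wd : WeierstrassCurve ℚ) [Wd.IsElliptic] [Wd.IsGloballyMinimal],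
        (∃ C : VariableChange ℚ, C • Wd = W.quadraticTwist (NumberField.discr K : ℚ)) →
        MissingUpperBoundAt Wd 3 := by
  have hevenφ : φ.Even := even_of_lineEven hΦ heven hφ0
  have hφ3 : φ (3 : ZMod m) = -1 :=
    phi_natCast_eq_neg_one_of_not_split_of_lineUnramifiedAt (W := W) (p := 3) (by decide) hc.2.1.2.2 hns hΦ hunr
      φ hpm hφ0
  obtain ⟨K, _, _, hK, hHN, hH3, hoddK, hlt, ⟨N₀, hHN₀, hS₀N₀⟩, hdK, hmK, hh⟩ :=
    exists_admissibleField_coprime_classNumber hNH (W.conductorNorm ℤ) W.conductorNorm_pos_holds d φ hφ hevenφ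
      hφ3 S₀
  exact upperPartner_at_of_unramifiedEven_of_classNumber_of_padicGZ W 3 hP hDis h311 hDGZ hc hns hΦ hunr heven φ ψ hφ
    hψ hpm hpd (isQuadratic_of_zmod_three φ) hφ0 hψ0 S₀ hS₀p hS hbal K hK hHN hH3 hoddK hlt hHN₀ hS₀N₀ hmK hdK hh

end Three

/-! ## §2. ANY rational `3`-line with a local balance ONE -/

/-- **Stub 6 (∃-PARTNER) at EVERY non-split X2b pair `(W, 3)`, for ANY rational `3`-line `Φ₀` with its primitive
characters and a local balance ONE — `K` CHOSEN, PUBLISHED inputs only**: LEAD g11's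
`…SubrowPartnerAnyLine.upperPartner_at_three_of_line_of_thmE` (p655437 §2) with `hDD` + `hKY` REPLACED by `hDGZ`: `¬GVPar`
makes the line ramified-odd or unramified-even, the Tate line at `3 ‖ N` decides `3 ∣ m ∧ 3 ∤ d` resp. `3 ∤ m ∧ 3 ∣ d`,
then §1. [cite: GreenbergVatsal2000, Thm. (1.3) and §2 pp. 26–28] [cite: SilvermanATAEC1994, Thm. V.5.3 and Cor. V.5.4]
[cite: NakagawaHorie1988, Thm. 1] [cite: Disegni2020, §2.2 Thm. 2.4 and §3.2 Thm. 4] -/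
theorem upperPartner_at_three_of_line_of_padicGZ (hP : EisensteinPrimes.PublishedInputs)
    (hDis : padicBSD_rankOne_nonsplitMult) (h311 : thm311_hasUnitContent_iff_and_order_eq_of_lineRamifiedEven)
    (hDGZ : padicGrossZagier_nonsplitMult)
    (hNH : Literature.NumberTheory.QuadraticFields.nakagawaHorie_taya_exists_imaginary_h3_eq_one)
    (W : WeierstrassCurve ℚ) [W.IsElliptic] [W.IsGloballyMinimal]
    (hc : X2.CellB W 3) (hns : ¬ W.HasSplitMultiplicativeReductionAtPrime 3)
    {Φ₀ : AddSubgroup (geomTorsion W (3 : ℤ))} (hΦ : IsRationalLine W 3 Φ₀)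
    {m : ℕ} [NeZero m] (φ : DirichletCharacter (ZMod 3) m) {d : ℕ} [NeZero d]
    (ψ : DirichletCharacter (ZMod 3) d) (hφ : φ.IsPrimitive) (hψ : ψ.IsPrimitive)
    (hφ0 : ∀ (σ : absoluteGaloisGroup ℚ), ∀ P ∈ Φ₀,
      σ • P = (φ ((modNCyclotomicCharacter ℚ m σ : (ZMod m)ˣ) : ZMod m)).val • P)
    (hψ0 : ∀ (σ : absoluteGaloisGroup ℚ) (P : geomTorsion W (3 : ℤ)),
      σ • P - (ψ ((modNCyclotomicCharacter ℚ d σ : (ZMod d)ˣ) : ZMod d)).val • P ∈ Φ₀)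
    (S₀ : Finset (HeightOneSpectrum (𝓞 ℚ))) (hS₀p : ∀ v ∈ S₀, ((3 : ℕ) : 𝓞 ℚ) ∉ v.asIdeal)
    (hS : ∀ v : HeightOneSpectrum (𝓞 ℚ), v ∉ S₀ → ((3 : ℕ) : 𝓞 ℚ) ∉ v.asIdeal → W.HasGoodReductionAt v)
    (hbal : 1 + ∑ v ∈ S₀, delta W 3 v =
      ∑ v ∈ S₀, ((if φ (Rat.HeightOneSpectrum.natGenerator v : ZMod m) =
            (Rat.HeightOneSpectrum.natGenerator v : ZMod 3)
          then sFactor 3 (Rat.HeightOneSpectrum.natGenerator v) else 0) +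
        (if ψ (Rat.HeightOneSpectrum.natGenerator v : ZMod d) =
            (Rat.HeightOneSpectrum.natGenerator v : ZMod 3)
          then sFactor 3 (Rat.HeightOneSpectrum.natGenerator v) else 0))) :
    ∃ (K : Type) (_ : Field K) (_ : NumberField K), IsImaginaryQuadratic K ∧
      SatisfiesHeegnerHypothesis (W.conductorNorm ℤ) K ∧ SatisfiesHeegnerHypothesis 3 K ∧
      Odd (NumberField.discr K) ∧ NumberField.discr K < -4 ∧
      (W.quadraticTwist (NumberField.discr K : ℚ)).analyticRank = 1 ∧
      ∀ (Wd : WeierstrassCurve ℚ) [Wd.IsElliptic] [Wd.IsGloballyMinimal],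
        (∃ C : VariableChange ℚ, C • Wd = W.quadraticTwist (NumberField.discr K : ℚ)) →
        MissingUpperBoundAt Wd 3 := by
  have hngv : ¬ GVPar W 3 := hc.2.2
  have hTate := IsogenyLineType.exists_tateLine_adicCompletionPrime W 3
    Silverman1994_thmV53_tateUniformisation_holds Silverman1994_thmV53_corV54_tateUniformisation_holds (by decide)
    hc.2.1.2.2
  rcases em (LineUnramifiedAt W 3 Φ₀) with hunr | hram
  · -- unramified ⟹ even (else GVPar), `3 ∤ m`, `3 ∣ d`
    have heven : LineEven W 3 Φ₀ :=
      (lineEven_or_lineOdd hΦ).resolve_right fun hodd ↦ hngv ⟨Φ₀, hΦ, Or.inr ⟨hunr, hodd⟩⟩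
    have hpm : ¬ 3 ∣ m := not_dvd_level_of_lineUnramifiedAt_of_line hΦ hunr hφ hφ0
    have hpd : 3 ∣ d := ResidualLineCharactersOdd.dvd_level_quot_of_lineUnramifiedAt hΦ hTate hunr hψ0
    exact upperPartner_at_three_of_unramifiedEven_of_padicGZ W hP hDis h311 hDGZ hNH hc hns hΦ hunr heven φ ψ hφ hψ
      hpm hpd hφ0 hψ0 S₀ hS₀p hS hbal
  · -- ramified ⟹ odd (else GVPar), `3 ∣ m`, `3 ∤ d`
    have hodd : LineOdd W 3 Φ₀ :=
      (lineEven_or_lineOdd hΦ).resolve_left fun hev ↦ hngv ⟨Φ₀, hΦ, Or.inl ⟨hram, hev⟩⟩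
    have hpm : 3 ∣ m := ResidualLineCharacters.dvd_level_of_not_lineUnramifiedAt hΦ hTate hram hφ0
    have hpd : ¬ 3 ∣ d :=
      ResidualLineCharacters.not_dvd_level_of_not_lineUnramifiedAt hΦ hTate hram hψ
        fun σ y ↦ ResidualLineCharacters.smul_quot_eq_of_forall_mem hΦ (hψ0 σ) y
    exact upperPartner_at_three_of_ramifiedOdd_of_padicGZ W hP hDis h311 hDGZ hNH hc hns hΦ hram hodd φ ψ hφ hψ hpm
      hpd hφ0 hψ0 S₀ hS₀p hS hbal

/-! ## §3. The line datum EXISTENTIAL: stub 6 on the sub-row «p = 3, non-split, c(E) = 1», PUBLISHED inputs only -/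

/-- **Stub 6 (∃-PARTNER) at EVERY non-split X2b pair `(W, 3)` of LOCAL BALANCE ONE, PUBLISHED inputs only** — LEAD
g11's `…SubrowPartnerAnyLine.upperPartner_at_three_of_balanceOne_of_thmE` (p655437 §3; the theorem the skeleton v5's
`upperPartner_onSubrow` instantiates) with `hDD` + `hKY` REPLACED by `hDGZ : padicGrossZagier_nonsplitMult`
(Disegni 2020 Thm. 2.4, PUB). The hypothesis is the existential «SOME rational `3`-line with SOME primitive characters
and SOME `S₀ ∌ (3)` off which `W` is good away from `3` has balance `1 + Σ_{S₀} δ_W = Σ_{S₀}(s[φ(ℓ)=ℓ̄] + s[ψ(ℓ)=ℓ̄])`»;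
the conclusion is `stub_upperPartner`'s body at `(W, 3)` VERBATIM. Named facts BY NAME: `PublishedInputs`
(modularity, Hoffstein–Luo, Gross–Zagier, Wuthrich Thm. 16, …), Disegni Thm. 4(1), GV Thm. (3.11), Nakagawa–Horie–Taya,
Disegni Thm. 2.4 — no preprint. [cite: Disegni2020, §2.2 Thm. 2.4 and §3.2 Thm. 4]
[cite: GreenbergVatsal2000, Thm. (1.3), §2 p. 28 and §3 Thm. (3.11)] [cite: NakagawaHorie1988, Thm. 1]
[cite: PerrinRiou1987, §1.4 Cor. 1.8] -/
theorem upperPartner_at_three_of_balanceOne_of_padicGZ (hP : EisensteinPrimes.PublishedInputs)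
    (hDis : padicBSD_rankOne_nonsplitMult) (h311 : thm311_hasUnitContent_iff_and_order_eq_of_lineRamifiedEven)
    (hDGZ : padicGrossZagier_nonsplitMult)
    (hNH : Literature.NumberTheory.QuadraticFields.nakagawaHorie_taya_exists_imaginary_h3_eq_one)
    (W : WeierstrassCurve ℚ) [W.IsElliptic] [W.IsGloballyMinimal]
    (hc : X2.CellB W 3) (hns : ¬ W.HasSplitMultiplicativeReductionAtPrime 3)
    (hbal : ∃ (Φ₀ : AddSubgroup (geomTorsion W (3 : ℤ))) (m : ℕ) (_ : NeZero m) (φ : DirichletCharacter (ZMod 3) m)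
        (d : ℕ) (_ : NeZero d) (ψ : DirichletCharacter (ZMod 3) d) (S₀ : Finset (HeightOneSpectrum (𝓞 ℚ))),
      IsRationalLine W 3 Φ₀ ∧ φ.IsPrimitive ∧ ψ.IsPrimitive ∧
      (∀ (σ : absoluteGaloisGroup ℚ), ∀ P ∈ Φ₀,
        σ • P = (φ ((modNCyclotomicCharacter ℚ m σ : (ZMod m)ˣ) : ZMod m)).val • P) ∧
      (∀ (σ : absoluteGaloisGroup ℚ) (P : geomTorsion W (3 : ℤ)),
        σ • P - (ψ ((modNCyclotomicCharacter ℚ d σ : (ZMod d)ˣ) : ZMod d)).val • P ∈ Φ₀) ∧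
      (∀ v ∈ S₀, ((3 : ℕ) : 𝓞 ℚ) ∉ v.asIdeal) ∧
      (∀ v : HeightOneSpectrum (𝓞 ℚ), v ∉ S₀ → ((3 : ℕ) : 𝓞 ℚ) ∉ v.asIdeal → W.HasGoodReductionAt v) ∧
      1 + ∑ v ∈ S₀, delta W 3 v =
        ∑ v ∈ S₀, ((if φ (Rat.HeightOneSpectrum.natGenerator v : ZMod m) =
              (Rat.HeightOneSpectrum.natGenerator v : ZMod 3)
            then sFactor 3 (Rat.HeightOneSpectrum.natGenerator v) else 0) +
          (if ψ (Rat.HeightOneSpectrum.natGenerator v : ZMod d) =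
              (Rat.HeightOneSpectrum.natGenerator v : ZMod 3)
            then sFactor 3 (Rat.HeightOneSpectrum.natGenerator v) else 0))) :
    ∃ (K : Type) (_ : Field K) (_ : NumberField K), IsImaginaryQuadratic K ∧
      SatisfiesHeegnerHypothesis (W.conductorNorm ℤ) K ∧ SatisfiesHeegnerHypothesis 3 K ∧
      Odd (NumberField.discr K) ∧ NumberField.discr K < -4 ∧
      (W.quadraticTwist (NumberField.discr K : ℚ)).analyticRank = 1 ∧
      ∀ (Wd : WeierstrassCurve ℚ) [Wd.IsElliptic] [Wd.IsGloballyMinimal],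
        (∃ C : VariableChange ℚ, C • Wd = W.quadraticTwist (NumberField.discr K : ℚ)) →
        MissingUpperBoundAt Wd 3 := by
  obtain ⟨Φ₀, m, im, φ, d, id, ψ, S₀, hΦ, hφ, hψ, hφ0, hψ0, hS₀p, hS, hb⟩ := hbal
  exact upperPartner_at_three_of_line_of_padicGZ hP hDis h311 hDGZ hNH W hc hns hΦ φ ψ hφ hψ hφ0 hψ0 S₀ hS₀p hS hb

end Summit.BirchSwinnertonDyer.BirchSwinnertonDyer.Theorems.EisensteinPrimesMazurMCOnCellBTwistbackSubrowPartnerAnyLinePAdicGZ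

end
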